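import Summits.NavierStokesRegularity.NavierStokesRegularity.Theorems.QuantisedSymmetryPolyhedralDssProfileExistsStubTraceWeakLimit
import Literature.Analysis.FluidPDE.CollapseDebris
import Literature.Analysis.FluidPDE.WholeSpaceIBP
import HarnessLib

/-!
# The weak curl of the scar is its pointwise curl — crux stmt-NavierStokesRegularity-1404
  (`QuantisedSymmetry.PolyhedralDssProfileExists`), line polyhedral_cell, stub stub_traceCurlWeak (N31)

Registered stub `stub_traceCurlWeak` (`--supports stmt-NavierStokesRegularity-1404`). Let
`V₀ : ℝ³ → ℝ³` be differentiable on `ℝ³ ∖ {0}` with continuous derivative there, with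
`‖x‖ ‖V₀ x‖ ≤ C₀` and `‖x‖² ‖DV₀ x‖ ≤ K`. Then for every test field `ψ ∈ C_c^∞(ℝ³; ℝ³)`,
`∫ ⟪V₀, curl ψ⟫ = ∫ ⟪curl V₀, ψ⟫`: the point singularity carries no vorticity mass.

Proof sketch (folklore; Majda–Bertozzi, *Vorticity and Incompressible Flow*, §1.2). Truncate the
scar with the tree cut-off `χ_R = cutoff R` (`= 1` on `‖x‖ ≤ R`, `= 0` off `‖x‖ < 2R`,
`‖Dχ_R‖ ≤ C/R`): the field `F_R = (1 - χ_R) V₀` is `C¹` on all of `ℝ³` (it vanishes on the ball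
`‖x‖ < R`), so the tree's whole-space integration by parts for the curl
(`integral_inner_curl_eq_integral_inner_curl`) gives `∫ ⟪F_R, curl ψ⟫ = ∫ ⟪curl F_R, ψ⟫`.
By the Leibniz rule (`curl_smul`), off the origin
`curl F_R = (1 - χ_R) curl V₀ + curlCLM (D(1 - χ_R) ⊗ V₀)`, and the remainder is bounded by
`‖curlCLM‖ ‖Dχ_R(x)‖ ‖V₀ x‖ ‖ψ x‖ ≤ 2 C C₀ ‖curlCLM‖ ‖x‖⁻² ‖ψ x‖` (since `Dχ_R` lives on
`‖x‖ ≤ 2R`, where `1/R ≤ 2/‖x‖`) and vanishes once `2R < ‖x‖`. As `R ↓ 0`: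
`∫ (1 - χ_R) ⟪V₀, curl ψ⟫ → ∫ ⟪V₀, curl ψ⟫`, `∫ (1 - χ_R) ⟪curl V₀, ψ⟫ → ∫ ⟪curl V₀, ψ⟫` and the
remainder integral tends to `0`, all by dominated convergence with the envelopes
`C₀ ‖x‖⁻¹ ‖curl ψ‖` and `c ‖x‖⁻² ‖ψ‖`, integrable because `‖x‖⁻¹, ‖x‖⁻² ∈ L¹_loc(ℝ³)`
(`NewtonPotentialHolder.integrableOn_ball_norm_rpow_neg`). Uniqueness of limits along `𝓝[>] 0`
concludes.
-/

noncomputable section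

-- the summit namespace `…NavierStokesRegularity.NavierStokesRegularity…` is the tree convention (D-0017)
set_option linter.dupNamespace false

namespace Summit.NavierStokesRegularity.NavierStokesRegularity.Theorems.PolyhedralDssProfileExists.PolyhedralCell

open MeasureTheory Set Function Filter Topology Metric
open Literature.Analysis Literature.Analysis.FluidPDE
open scoped InnerProductSpace RealInnerProductSpace

section TraceCurlWeak

variable {V₀ ψ : EuclideanSpace ℝ (Fin 3) → EuclideanSpace ℝ (Fin 3)} {C₀ K R : ℝ}

/-! ### Pointwise bounds off the origin -/

/-- `‖V₀ x‖ ≤ C₀ ‖x‖⁻¹` for `x ≠ 0` (from `‖x‖ ‖V₀ x‖ ≤ C₀`). -/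
theorem traceCurlWeak_norm_le (hV : ∀ x, ‖x‖ * ‖V₀ x‖ ≤ C₀) {x : EuclideanSpace ℝ (Fin 3)}
    (hx : x ≠ 0) : ‖V₀ x‖ ≤ C₀ * ‖x‖⁻¹ := by
  rw [← div_eq_mul_inv, le_div_iff₀ (norm_pos_iff.2 hx), mul_comm]
  exact hV x

/-- `‖DV₀ x‖ ≤ K ‖x‖⁻²` for `x ≠ 0` (from `‖x‖² ‖DV₀ x‖ ≤ K`). -/
theorem traceCurlWeak_norm_fderiv_le (hDV : ∀ x, ‖x‖ ^ 2 * ‖fderiv ℝ V₀ x‖ ≤ K)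
    {x : EuclideanSpace ℝ (Fin 3)} (hx : x ≠ 0) : ‖fderiv ℝ V₀ x‖ ≤ K * (‖x‖ ^ 2)⁻¹ := by
  rw [← div_eq_mul_inv, le_div_iff₀ (pow_pos (norm_pos_iff.2 hx) 2), mul_comm]
  exact hDV x

/-- `‖curl V₀ x‖ ≤ ‖curlCLM‖ K ‖x‖⁻²` for `x ≠ 0` (`curl = curlCLM ∘ D`, `norm_curl_le`). -/
theorem traceCurlWeak_norm_curl_le (hDV : ∀ x, ‖x‖ ^ 2 * ‖fderiv ℝ V₀ x‖ ≤ K)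
    {x : EuclideanSpace ℝ (Fin 3)} (hx : x ≠ 0) :
    ‖curl V₀ x‖ ≤ ‖curlCLM‖ * K * (‖x‖ ^ 2)⁻¹ := by
  calc ‖curl V₀ x‖ ≤ ‖curlCLM‖ * ‖fderiv ℝ V₀ x‖ := norm_curl_le V₀ x
    _ ≤ ‖curlCLM‖ * (K * (‖x‖ ^ 2)⁻¹) := by
        gcongr
        exact traceCurlWeak_norm_fderiv_le hDV hx
    _ = ‖curlCLM‖ * K * (‖x‖ ^ 2)⁻¹ := by ring

/-- The envelope `C ‖x‖⁻²` is locally integrable on `ℝ³` (`‖x‖⁻² ∈ L¹(B_r)` for every `r`,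
`NewtonPotentialHolder.integrableOn_ball_norm_rpow_neg` with exponent `2 < 3`). -/
theorem traceCurlWeak_locallyIntegrable_envelope (C : ℝ) :
    LocallyIntegrable (fun x : EuclideanSpace ℝ (Fin 3) => C * (‖x‖ ^ 2)⁻¹) volume := by
  have hI : ∀ r : ℝ,
      IntegrableOn (fun x : EuclideanSpace ℝ (Fin 3) => C * (‖x‖ ^ 2)⁻¹) (ball 0 r) volume :=
    fun r => ((NewtonPotentialHolder.integrableOn_ball_norm_rpow_neg (s := 2) (by norm_num)
      r).congr_fun (fun y _ => by rw [Real.rpow_neg (norm_nonneg _), Real.rpow_two])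
      measurableSet_ball).const_mul C
  exact fun x => ⟨ball 0 (‖x‖ + 1), isOpen_ball.mem_nhds (mem_ball_zero_iff.2 (lt_add_one _)),
    hI _⟩

/-! ### The cut-off `cutoff R` near the origin -/

/-- Gradient of the tree cut-off `cutoff R` (`= 1` on `‖x‖ ≤ R`, `= 0` off `‖x‖ < 2R`,
`‖D(cutoff R)‖ ≤ C/R`): for `x ≠ 0`, `‖D(cutoff R)(x)‖ ≤ 2C ‖x‖⁻¹` uniformly in `R > 0` (the
gradient lives where `‖x‖ ≤ 2R`, i.e. `1/R ≤ 2/‖x‖`), and `D(cutoff R)(x) = 0` once `2R < ‖x‖`. -/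
theorem traceCurlWeak_fderiv_cutoff :
    ∃ C : ℝ, 0 ≤ C ∧ ∀ R : ℝ, 0 < R → ∀ x : EuclideanSpace ℝ (Fin 3), x ≠ 0 →
      ‖fderiv ℝ (cutoff R) x‖ ≤ 2 * C * ‖x‖⁻¹ ∧ (2 * R < ‖x‖ → fderiv ℝ (cutoff R) x = 0) := by
  obtain ⟨C, hC0, hC⟩ := exists_norm_fderiv_cutoff_le (E := EuclideanSpace ℝ (Fin 3))
  refine ⟨C, hC0, fun R hR x hx => ?_⟩
  have hzero : 2 * R < ‖x‖ → fderiv ℝ (cutoff R) x = 0 := fun h => by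
    have hev : (cutoff R : EuclideanSpace ℝ (Fin 3) → ℝ) =ᶠ[𝓝 x] fun _ => (0 : ℝ) := by
      filter_upwards [(isOpen_lt continuous_const continuous_norm).mem_nhds h] with y hy
      exact cutoff_eq_zero hR hy.le
    rw [hev.fderiv_eq, fderiv_const_apply]
  refine ⟨?_, hzero⟩
  by_cases h : 2 * R < ‖x‖
  · rw [hzero h, norm_zero]; positivity
  · have hxpos : 0 < ‖x‖ := norm_pos_iff.2 hx
    have h2 : C * ‖x‖ ≤ C * (2 * R) := mul_le_mul_of_nonneg_left (not_lt.1 h) hC0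
    calc ‖fderiv ℝ (cutoff R) x‖ ≤ C / R := hC R hR x
      _ ≤ 2 * C * ‖x‖⁻¹ := by
        rw [← div_eq_mul_inv, div_le_div_iff₀ hR hxpos]
        linarith

/-- For `x ≠ 0`, eventually as `R ↓ 0` (namely for `0 < R < ‖x‖/2`) the point `x` lies outside the
transition shell: `0 < R` and `2R < ‖x‖`. -/
theorem traceCurlWeak_eventually {x : EuclideanSpace ℝ (Fin 3)} (hx : x ≠ 0) :
    ∀ᶠ R in 𝓝[>] (0 : ℝ), 0 < R ∧ 2 * R < ‖x‖ := by
  have hx' : (0 : ℝ) < ‖x‖ / 2 := half_pos (norm_pos_iff.2 hx)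
  filter_upwards [Ioo_mem_nhdsGT hx'] with R hR
  exact ⟨hR.1, by linarith [hR.2]⟩

/-- For `x ≠ 0`, `1 - cutoff R x → 1` as `R ↓ 0` (it equals `1` once `2R ≤ ‖x‖`); multiplied by a
fixed number `a`. -/
theorem traceCurlWeak_tendsto_one_sub_cutoff_mul {x : EuclideanSpace ℝ (Fin 3)} (hx : x ≠ 0)
    (a : ℝ) : Tendsto (fun R => (1 - cutoff R x) * a) (𝓝[>] (0 : ℝ)) (𝓝 a) := by
  refine (tendsto_const_nhds (x := a)).congr' ?_
  filter_upwards [traceCurlWeak_eventually hx] with R hR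
  rw [cutoff_eq_zero hR.1 hR.2.le, sub_zero, one_mul]

/-- `|1 - cutoff R x| ≤ 1` (the cut-off takes values in `[0, 1]`). -/
theorem traceCurlWeak_abs_one_sub_cutoff_le (R : ℝ) (x : EuclideanSpace ℝ (Fin 3)) :
    |1 - cutoff R x| ≤ 1 :=
  abs_le.2 ⟨by linarith [cutoff_le_one R x], by linarith [cutoff_nonneg R x]⟩

/-! ### The truncated scar `(1 - cutoff R) V₀` -/

/-- The truncated scar `x ↦ (1 - cutoff R x) • V₀ x` (`R > 0`) is `C¹` on all of `ℝ³`: `V₀` is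
`C¹` on the open set `{x ≠ 0}` (differentiable with continuous derivative there), the cut-off
factor is smooth, and the product vanishes identically on the ball `‖x‖ < R` about the origin. -/
theorem traceCurlWeak_contDiff (hd : DifferentiableOn ℝ V₀ {x | x ≠ 0})
    (hc : ContinuousOn (fderiv ℝ V₀) {x | x ≠ 0}) (hR : 0 < R) :
    ContDiff ℝ 1 fun x => (1 - cutoff R x) • V₀ x := by
  have h1 : ContDiffOn ℝ 1 V₀ {x : EuclideanSpace ℝ (Fin 3) | x ≠ 0} := by
    rw [show (1 : WithTop ℕ∞) = 0 + 1 from (zero_add 1).symm,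
      contDiffOn_succ_iff_fderiv_of_isOpen isOpen_ne]
    exact ⟨hd, fun h => absurd h (by simp), contDiffOn_zero.2 hc⟩
  have hη : ContDiff ℝ 1 fun x : EuclideanSpace ℝ (Fin 3) => 1 - cutoff R x :=
    contDiff_const.sub (contDiff_cutoff R)
  refine contDiff_iff_contDiffAt.2 fun x => ?_
  by_cases hx : x = 0
  · subst hx
    have hev : (fun x => (1 - cutoff R x) • V₀ x) =ᶠ[𝓝 (0 : EuclideanSpace ℝ (Fin 3))]
        fun _ => 0 := by
      filter_upwards [ball_mem_nhds (0 : EuclideanSpace ℝ (Fin 3)) hR] with y hy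
      rw [cutoff_eq_one hR (mem_ball_zero_iff.1 hy).le, sub_self, zero_smul]
    exact contDiffAt_const.congr_of_eventuallyEq hev
  · exact hη.contDiffAt.smul (h1.contDiffAt (isOpen_ne.mem_nhds hx))

/-- **Leibniz remainder.** At `x ≠ 0` (`curl_smul`):
`⟪curl((1 - χ_R) V₀)(x), ψ x⟫ - (1 - χ_R x) ⟪curl V₀ x, ψ x⟫ = ⟪curlCLM (D(1 - χ_R)(x) ⊗ V₀ x), ψ x⟫`
and the right-hand side is bounded by `‖curlCLM‖ ‖D(cutoff R)(x)‖ ‖V₀ x‖ ‖ψ x‖`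
(`norm_curlCLM_smulRight_le`). -/
theorem traceCurlWeak_remainder_le (hd : DifferentiableOn ℝ V₀ {x | x ≠ 0}) (R : ℝ)
    (ψ : EuclideanSpace ℝ (Fin 3) → EuclideanSpace ℝ (Fin 3)) {x : EuclideanSpace ℝ (Fin 3)}
    (hx : x ≠ 0) :
    |⟪curl (fun y => (1 - cutoff R y) • V₀ y) x, ψ x⟫_ℝ - (1 - cutoff R x) * ⟪curl V₀ x, ψ x⟫_ℝ| ≤
      ‖curlCLM‖ * (‖fderiv ℝ (cutoff R) x‖ * ‖V₀ x‖) * ‖ψ x‖ := by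
  have hη1 : ContDiff ℝ 1 fun y : EuclideanSpace ℝ (Fin 3) => 1 - cutoff R y :=
    contDiff_const.sub (contDiff_cutoff R)
  have hη : DifferentiableAt ℝ (fun y : EuclideanSpace ℝ (Fin 3) => 1 - cutoff R y) x :=
    (hη1.differentiable one_ne_zero).differentiableAt
  rw [curl_smul hη (hd.differentiableAt (isOpen_ne.mem_nhds hx)), inner_add_left,
    real_inner_smul_left, add_sub_cancel_left, fderiv_const_sub]
  calc |⟪curlCLM ((-fderiv ℝ (cutoff R) x).smulRight (V₀ x)), ψ x⟫_ℝ|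
      ≤ ‖curlCLM ((-fderiv ℝ (cutoff R) x).smulRight (V₀ x))‖ * ‖ψ x‖ :=
        abs_real_inner_le_norm _ _
    _ ≤ ‖curlCLM‖ * (‖fderiv ℝ (cutoff R) x‖ * ‖V₀ x‖) * ‖ψ x‖ := by
        gcongr
        simpa only [norm_neg] using norm_curlCLM_smulRight_le (-fderiv ℝ (cutoff R) x) (V₀ x)

/-- **The truncated identity.** For `R > 0` and `ψ ∈ C¹_c`,
`∫ (1 - χ_R) ⟪V₀, curl ψ⟫ = ∫ ⟪curl((1 - χ_R) V₀), ψ⟫` — the tree's whole-space integration by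
parts for the curl applied to the `C¹` field `(1 - χ_R) V₀`. -/
theorem traceCurlWeak_truncated (hd : DifferentiableOn ℝ V₀ {x | x ≠ 0})
    (hc : ContinuousOn (fderiv ℝ V₀) {x | x ≠ 0}) (hR : 0 < R) (hψ1 : ContDiff ℝ 1 ψ)
    (hψc : HasCompactSupport ψ) :
    ∫ x, (1 - cutoff R x) * ⟪V₀ x, curl ψ x⟫_ℝ =
      ∫ x, ⟪curl (fun y => (1 - cutoff R y) • V₀ y) x, ψ x⟫_ℝ := by
  rw [integral_inner_curl_eq_integral_inner_curl (traceCurlWeak_contDiff hd hc hR) hψ1 hψc]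
  exact integral_congr_ae (Eventually.of_forall fun x => (real_inner_smul_left _ _ _).symm)

/-! ### The three limits `R ↓ 0` -/

/-- `∫ (1 - χ_R) ⟪V₀, curl ψ⟫ → ∫ ⟪V₀, curl ψ⟫` as `R ↓ 0`: dominated convergence with the
integrable envelope `C₀ ‖x‖⁻¹ ‖curl ψ x‖` (`1 - χ_R ∈ [0, 1]` tends to `1` off the origin;
measurability through the continuous truncations `(1 - χ_R) V₀`). -/
theorem traceCurlWeak_tendsto_left (hd : DifferentiableOn ℝ V₀ {x | x ≠ 0})
    (hc : ContinuousOn (fderiv ℝ V₀) {x | x ≠ 0}) (hV : ∀ x, ‖x‖ * ‖V₀ x‖ ≤ C₀)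
    (hψ1 : ContDiff ℝ 1 ψ) (hψc : HasCompactSupport ψ) :
    Tendsto (fun R => ∫ x, (1 - cutoff R x) * ⟪V₀ x, curl ψ x⟫_ℝ) (𝓝[>] (0 : ℝ))
      (𝓝 (∫ x, ⟪V₀ x, curl ψ x⟫_ℝ)) := by
  refine tendsto_integral_filter_of_dominated_convergence (fun x => C₀ * ‖x‖⁻¹ * ‖curl ψ x‖)
    ?_ ?_ ?_ ?_
  · filter_upwards [self_mem_nhdsWithin] with R hR
    have heq : (fun x => (1 - cutoff R x) * ⟪V₀ x, curl ψ x⟫_ℝ) =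
        fun x => ⟪(1 - cutoff R x) • V₀ x, curl ψ x⟫_ℝ :=
      funext fun x => (real_inner_smul_left _ _ _).symm
    rw [heq]
    exact ((traceCurlWeak_contDiff hd hc hR).continuous.inner
      (continuous_curl hψ1)).aestronglyMeasurable
  · refine Eventually.of_forall fun R => ?_
    filter_upwards [traceWeakLimit_ae_ne_zero] with x hx
    rw [Real.norm_eq_abs, abs_mul]
    calc |1 - cutoff R x| * |⟪V₀ x, curl ψ x⟫_ℝ| ≤ 1 * (‖V₀ x‖ * ‖curl ψ x‖) := by
          gcongr
          · exact traceCurlWeak_abs_one_sub_cutoff_le R x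
          · exact abs_real_inner_le_norm _ _
      _ ≤ 1 * (C₀ * ‖x‖⁻¹ * ‖curl ψ x‖) := by
          gcongr
          exact traceCurlWeak_norm_le hV hx
      _ = C₀ * ‖x‖⁻¹ * ‖curl ψ x‖ := one_mul _
  · simpa only [smul_eq_mul] using
      (traceWeakLimit_locallyIntegrable_envelope C₀).integrable_smul_right_of_hasCompactSupport
        (continuous_curl hψ1).norm (hasCompactSupport_curl hψc).norm
  · filter_upwards [traceWeakLimit_ae_ne_zero] with x hx
    exact traceCurlWeak_tendsto_one_sub_cutoff_mul hx _

/-- `∫ (1 - χ_R) ⟪curl V₀, ψ⟫ → ∫ ⟪curl V₀, ψ⟫` as `R ↓ 0`: dominated convergence with the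
integrable envelope `‖curlCLM‖ K ‖x‖⁻² ‖ψ x‖` (`curl V₀` is measurable for every `V₀`,
`measurable_curl`). -/
theorem traceCurlWeak_tendsto_right (hDV : ∀ x, ‖x‖ ^ 2 * ‖fderiv ℝ V₀ x‖ ≤ K)
    (hψ1 : ContDiff ℝ 1 ψ) (hψc : HasCompactSupport ψ) :
    Tendsto (fun R => ∫ x, (1 - cutoff R x) * ⟪curl V₀ x, ψ x⟫_ℝ) (𝓝[>] (0 : ℝ))
      (𝓝 (∫ x, ⟪curl V₀ x, ψ x⟫_ℝ)) := by
  have hm : AEStronglyMeasurable (fun x => ⟪curl V₀ x, ψ x⟫_ℝ) volume :=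
    (measurable_curl V₀).aestronglyMeasurable.inner
      hψ1.continuous.aestronglyMeasurable
  refine tendsto_integral_filter_of_dominated_convergence
    (fun x => ‖curlCLM‖ * K * (‖x‖ ^ 2)⁻¹ * ‖ψ x‖) ?_ ?_ ?_ ?_
  · exact Eventually.of_forall fun R =>
      (continuous_const.sub (contDiff_cutoff (n := 0) R).continuous).aestronglyMeasurable.mul hm
  · refine Eventually.of_forall fun R => ?_
    filter_upwards [traceWeakLimit_ae_ne_zero] with x hx
    rw [Real.norm_eq_abs, abs_mul]
    calc |1 - cutoff R x| * |⟪curl V₀ x, ψ x⟫_ℝ| ≤ 1 * (‖curl V₀ x‖ * ‖ψ x‖) := by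
          gcongr
          · exact traceCurlWeak_abs_one_sub_cutoff_le R x
          · exact abs_real_inner_le_norm _ _
      _ ≤ 1 * (‖curlCLM‖ * K * (‖x‖ ^ 2)⁻¹ * ‖ψ x‖) := by
          gcongr
          exact traceCurlWeak_norm_curl_le hDV hx
      _ = ‖curlCLM‖ * K * (‖x‖ ^ 2)⁻¹ * ‖ψ x‖ := one_mul _
  · simpa only [smul_eq_mul] using
      (traceCurlWeak_locallyIntegrable_envelope (‖curlCLM‖ * K))
        |>.integrable_smul_right_of_hasCompactSupport hψ1.continuous.norm hψc.norm
  · filter_upwards [traceWeakLimit_ae_ne_zero] with x hx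
    exact traceCurlWeak_tendsto_one_sub_cutoff_mul hx _

/-- The Leibniz remainder integrates to `o(1)` as `R ↓ 0`:
`∫ (⟪curl((1 - χ_R) V₀), ψ⟫ - (1 - χ_R) ⟪curl V₀, ψ⟫) → 0`, by dominated convergence: the
integrand is bounded by `2 C C₀ ‖curlCLM‖ ‖x‖⁻² ‖ψ x‖` (integrable) and vanishes at `x ≠ 0` once
`2R < ‖x‖`. -/
theorem traceCurlWeak_tendsto_remainder (hd : DifferentiableOn ℝ V₀ {x | x ≠ 0})
    (hc : ContinuousOn (fderiv ℝ V₀) {x | x ≠ 0}) (hV : ∀ x, ‖x‖ * ‖V₀ x‖ ≤ C₀)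
    (hψ1 : ContDiff ℝ 1 ψ) (hψc : HasCompactSupport ψ) :
    Tendsto (fun R => ∫ x, (⟪curl (fun y => (1 - cutoff R y) • V₀ y) x, ψ x⟫_ℝ -
      (1 - cutoff R x) * ⟪curl V₀ x, ψ x⟫_ℝ)) (𝓝[>] (0 : ℝ)) (𝓝 0) := by
  obtain ⟨C, hC0, hC⟩ := traceCurlWeak_fderiv_cutoff
  have hm : AEStronglyMeasurable (fun x => ⟪curl V₀ x, ψ x⟫_ℝ) volume :=
    (measurable_curl V₀).aestronglyMeasurable.inner
      hψ1.continuous.aestronglyMeasurable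
  suffices h : Tendsto (fun R => ∫ x, (⟪curl (fun y => (1 - cutoff R y) • V₀ y) x, ψ x⟫_ℝ -
      (1 - cutoff R x) * ⟪curl V₀ x, ψ x⟫_ℝ)) (𝓝[>] (0 : ℝ))
      (𝓝 (∫ _ : EuclideanSpace ℝ (Fin 3), (0 : ℝ))) by
    simpa only [integral_zero] using h
  refine tendsto_integral_filter_of_dominated_convergence
    (fun x => ‖curlCLM‖ * (2 * C * C₀) * (‖x‖ ^ 2)⁻¹ * ‖ψ x‖) ?_ ?_ ?_ ?_
  · filter_upwards [self_mem_nhdsWithin] with R hR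
    exact (((continuous_curl (traceCurlWeak_contDiff hd hc hR)).inner
      hψ1.continuous).aestronglyMeasurable).sub
      ((continuous_const.sub (contDiff_cutoff (n := 0) R).continuous).aestronglyMeasurable.mul hm)
  · filter_upwards [self_mem_nhdsWithin] with R hR
    filter_upwards [traceWeakLimit_ae_ne_zero] with x hx
    rw [Real.norm_eq_abs]
    refine (traceCurlWeak_remainder_le hd R ψ hx).trans ?_
    have h1 : ‖fderiv ℝ (cutoff R) x‖ * ‖V₀ x‖ ≤ (2 * C * ‖x‖⁻¹) * (C₀ * ‖x‖⁻¹) :=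
      mul_le_mul (hC R hR x hx).1 (traceCurlWeak_norm_le hV hx) (norm_nonneg _)
        (by positivity)
    have h2 : (2 * C * ‖x‖⁻¹) * (C₀ * ‖x‖⁻¹) = 2 * C * C₀ * (‖x‖ ^ 2)⁻¹ := by ring
    rw [h2] at h1
    calc ‖curlCLM‖ * (‖fderiv ℝ (cutoff R) x‖ * ‖V₀ x‖) * ‖ψ x‖
        ≤ ‖curlCLM‖ * (2 * C * C₀ * (‖x‖ ^ 2)⁻¹) * ‖ψ x‖ := by gcongr
      _ = ‖curlCLM‖ * (2 * C * C₀) * (‖x‖ ^ 2)⁻¹ * ‖ψ x‖ := by ring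
  · simpa only [smul_eq_mul] using
      (traceCurlWeak_locallyIntegrable_envelope (‖curlCLM‖ * (2 * C * C₀)))
        |>.integrable_smul_right_of_hasCompactSupport hψ1.continuous.norm hψc.norm
  · filter_upwards [traceWeakLimit_ae_ne_zero] with x hx
    refine (tendsto_const_nhds (x := (0 : ℝ))).congr' ?_
    filter_upwards [traceCurlWeak_eventually hx] with R hR
    have h := traceCurlWeak_remainder_le hd R ψ hx
    rw [(hC R hR.1 x hx).2 hR.2, norm_zero, zero_mul, mul_zero, zero_mul] at h
    exact (abs_nonpos_iff.1 h).symm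

end TraceCurlWeak

/-- **Stub `stub_traceCurlWeak` (N31): the weak curl of the scar is its pointwise curl (the origin
carries no vorticity mass).** For `V₀ : ℝ³ → ℝ³` differentiable on `ℝ³ ∖ {0}` with continuous
derivative there, `‖x‖ ‖V₀ x‖ ≤ C₀` and `‖x‖² ‖DV₀ x‖ ≤ K`, and every test field `ψ`:
`∫ ⟪V₀, curl ψ⟫ = ∫ ⟪curl V₀, ψ⟫`. Proof: truncate with `1 - cutoff R` (`traceCurlWeak_truncated`,
whole-space integration by parts for the `C¹` field `(1 - χ_R) V₀`), split off the Leibniz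
remainder, and let `R ↓ 0` in the three pieces (`traceCurlWeak_tendsto_left`,
`traceCurlWeak_tendsto_right`, `traceCurlWeak_tendsto_remainder`); uniqueness of limits along the
`NeBot` filter `𝓝[>] 0`. -/
theorem stub_traceCurlWeak :
    ∀ (V₀ : EuclideanSpace ℝ (Fin 3) → EuclideanSpace ℝ (Fin 3)) (C₀ K : ℝ),
      DifferentiableOn ℝ V₀ {x | x ≠ 0} → ContinuousOn (fderiv ℝ V₀) {x | x ≠ 0} →
      (∀ x, ‖x‖ * ‖V₀ x‖ ≤ C₀) → (∀ x, ‖x‖ ^ 2 * ‖fderiv ℝ V₀ x‖ ≤ K) →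
      ∀ ψ : EuclideanSpace ℝ (Fin 3) → EuclideanSpace ℝ (Fin 3),
        Literature.Analysis.FunctionSpaces.IsTestFunctionOn
          (⊤ : TopologicalSpace.Opens (EuclideanSpace ℝ (Fin 3))) ψ →
        ∫ x, ⟪V₀ x, curl ψ x⟫_ℝ = ∫ x, ⟪curl V₀ x, ψ x⟫_ℝ := by
  intro V₀ C₀ K hd hc hV hDV ψ hψ
  have hψ1 : ContDiff ℝ 1 ψ := hψ.contDiff.of_le (by exact_mod_cast le_top)
  have hψc : HasCompactSupport ψ := hψ.hasCompactSupport
  have T1 := traceCurlWeak_tendsto_left hd hc hV hψ1 hψc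
  have T2 := traceCurlWeak_tendsto_right (V₀ := V₀) hDV hψ1 hψc
  have T3 := traceCurlWeak_tendsto_remainder hd hc hV hψ1 hψc
  -- integrability of the main right-hand piece (dominated by `‖curlCLM‖ K ‖x‖⁻² ‖ψ x‖`)
  have hI2 : ∀ R : ℝ, Integrable (fun x => (1 - cutoff R x) * ⟪curl V₀ x, ψ x⟫_ℝ) volume := by
    intro R
    have hm : AEStronglyMeasurable (fun x => ⟪curl V₀ x, ψ x⟫_ℝ) volume :=
      (measurable_curl V₀).aestronglyMeasurable.inner
        hψ1.continuous.aestronglyMeasurable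
    refine Integrable.mono'
      (by simpa only [smul_eq_mul] using
        (traceCurlWeak_locallyIntegrable_envelope (‖curlCLM‖ * K))
          |>.integrable_smul_right_of_hasCompactSupport hψ1.continuous.norm hψc.norm)
      ((continuous_const.sub (contDiff_cutoff (n := 0) R).continuous).aestronglyMeasurable.mul hm)
      ?_
    filter_upwards [traceWeakLimit_ae_ne_zero] with x hx
    rw [Real.norm_eq_abs, abs_mul]
    calc |1 - cutoff R x| * |⟪curl V₀ x, ψ x⟫_ℝ| ≤ 1 * (‖curl V₀ x‖ * ‖ψ x‖) := by
          gcongr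
          · exact traceCurlWeak_abs_one_sub_cutoff_le R x
          · exact abs_real_inner_le_norm _ _
      _ ≤ 1 * (‖curlCLM‖ * K * (‖x‖ ^ 2)⁻¹ * ‖ψ x‖) := by
          gcongr
          exact traceCurlWeak_norm_curl_le hDV hx
      _ = ‖curlCLM‖ * K * (‖x‖ ^ 2)⁻¹ * ‖ψ x‖ := one_mul _
  -- the truncated identity, split into main piece and remainder, for every `R > 0`
  have heq : (fun R => ∫ x, (1 - cutoff R x) * ⟪V₀ x, curl ψ x⟫_ℝ) =ᶠ[𝓝[>] (0 : ℝ)]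
      fun R => (∫ x, (1 - cutoff R x) * ⟪curl V₀ x, ψ x⟫_ℝ) +
        ∫ x, (⟪curl (fun y => (1 - cutoff R y) • V₀ y) x, ψ x⟫_ℝ -
          (1 - cutoff R x) * ⟪curl V₀ x, ψ x⟫_ℝ) := by
    filter_upwards [self_mem_nhdsWithin] with R hR
    have hI1 : Integrable (fun x => ⟪curl (fun y => (1 - cutoff R y) • V₀ y) x, ψ x⟫_ℝ) volume :=
      ((continuous_curl (traceCurlWeak_contDiff hd hc hR)).inner hψ1.continuous)
        |>.integrable_of_hasCompactSupport (hψc.mono fun x hx => by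
          contrapose! hx
          simp only [mem_support, not_not] at hx
          simp [hx])
    rw [traceCurlWeak_truncated hd hc hR hψ1 hψc, ← integral_add (hI2 R) (hI1.sub' (hI2 R))]
    exact integral_congr_ae (Eventually.of_forall fun x => by ring)
  have T23 := T2.add T3
  rw [add_zero] at T23
  exact tendsto_nhds_unique (T1.congr' heq) T23

end Summit.NavierStokesRegularity.NavierStokesRegularity.Theorems.PolyhedralDssProfileExists.PolyhedralCell
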